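import Summits.QuantumFields.YangMills.Theorems.EquipartitionCriticalityEquipartitionPinsProbeTangentDefs
import Summits.QuantumFields.YangMills.Theorems.EquipartitionCriticalityFreeEnergyLogCoefficientExpChartBasic
import Literature.MathematicalPhysics.QuantumFieldTheory.UnitaryCayleyChart
import HarnessLib

/-!
# `EquipartitionPinsProbe` (crux `stmt-QuantumFields-8760`), line `Sketch` — stub `stub_lieFrame`

Route `EquipartitionCriticality` of `QuantumFields/YangMills`, crux
`Summit.QuantumFields.YangMills.Theses.EquipartitionCriticality.EquipartitionPinsProbe`, line `Sketch`,
stub `stub_lieFrame` (TL). For a lattice representation `r` of a compact group `G`, the frame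
`e_a = lieVec r a`, `a : Fin (lieDim r)`, of the Lie algebra `𝔤_r = span ℝ {X | exp(tX) ∈ r(G) ∀ t}`:

1. is orthonormal for the Hilbert–Schmidt inner product, `lieCoord r e_a b = Re tr(e_a e_b†) = δ_ab`;
2. consists of skew-Hermitian matrices;
3. consists of generators of one-parameter subgroups of `r(G)` (`exp(t e_a) ∈ r(G)`);
4. spans `𝔤_r`, with coordinates `lieCoord r X a = Re tr(X e_a†)`: `X = Σ_a lieCoord r X a • e_a`;
5. satisfies Bessel's inequality `Σ_a (Re tr(M e_a†))² ≤ Re tr(M M†) = ‖M‖_F²` for every matrix `M`.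

Proof: under the tree's real Hilbert–Schmidt inner product space structure
`frobeniusInnerProductSpace` (`⟨A, B⟩ = Re tr(A† B)`, whose norm is the Frobenius norm; enabled
inside the proof by `letI`) the
parametrisation `FreeEnergyLogCoefficient.lieIso r.ρ : ℝ^D →ₗᵢ[ℝ] M_N(ℂ)` preserves inner products,
and `lieVec r` is the image of the standard orthonormal basis of `ℝ^D`; so the frame is an
orthonormal family (`Orthonormal.comp_linearIsometry`), (5) is Mathlib's Bessel inequality
`Orthonormal.sum_inner_products_le`, (3) is `lieIso_mem` with the closed-subgroup theorem
`mem_repLieAlgebra_iff`, and (4) is `exists_lieIso_eq` plus the expansion of a vector of `ℝ^D` in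
the standard basis (`OrthonormalBasis.sum_repr`).

References: B. C. Hall, GTM 222 (2015), Def. 3.18, Thm. 3.20, Prop. 3.24; S. Chatterjee,
arXiv:1602.01222, §11.
-/

noncomputable section

open scoped Matrix Matrix.Norms.Frobenius
open NormedSpace
open Literature.MathematicalPhysics.QuantumLattice Literature.MathematicalPhysics.QuantumFieldTheory

namespace Summit.QuantumFields.YangMills.Theorems.EquipartitionPinsProbe

namespace TangentLieFrame

variable {G : Type} [Group G] [TopologicalSpace G] (r : LatticeRep G)

/-- `lieVec r a` is the image under `lieIso r.ρ` of the standard basis vector of `ℝ^D` with index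
`a` transported along `dimE_eq_lieDim`. [folklore] -/
theorem lieVec_eq (a : Fin (lieDim r)) :
    lieVec r a = FreeEnergyLogCoefficient.lieIso r.ρ
      (EuclideanSpace.basisFun (Fin (FreeEnergyLogCoefficient.dimE r.ρ)) ℝ
        (finCongr (dimE_eq_lieDim r).symm a)) := by
  rw [lieVec, EuclideanSpace.basisFun_apply]

/-- The frame as a composite: `lieVec r = lieIso r.ρ ∘ basisFun ∘ finCongr _`. [folklore] -/
theorem lieVec_eq_comp :
    lieVec r = (⇑(FreeEnergyLogCoefficient.lieIso r.ρ) ∘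
      ⇑(EuclideanSpace.basisFun (Fin (FreeEnergyLogCoefficient.dimE r.ρ)) ℝ)) ∘
        ⇑(finCongr (dimE_eq_lieDim r).symm) :=
  funext fun a => lieVec_eq r a

/-- `Re tr(M M†) = ‖M‖_F²` (Frobenius norm). [folklore] -/
theorem trace_mul_conjTranspose_re (M : Matrix (Fin r.N) (Fin r.N) ℂ) :
    (M * Mᴴ).trace.re = ‖M‖ ^ 2 := by
  rw [Matrix.frobenius_norm_sq_eq_re_trace, Matrix.trace_mul_comm, RCLike.re_to_complex]

end TangentLieFrame

open TangentLieFrame in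
/-- **Stub `stub_lieFrame` (TL)**: for a lattice representation `r` of a compact group, the frame
`e_a = lieVec r a` (`a : Fin (lieDim r)`) is orthonormal for `Re tr(X Y†)`
(`lieCoord r e_a b = δ_ab`), skew-Hermitian, generates one-parameter subgroups of `r(G)`, spans the
Lie algebra `span ℝ {X | exp(tX) ∈ r(G) ∀ t}` with coordinates `lieCoord r X a = Re tr(X e_a†)`, and
satisfies Bessel's inequality `Σ_a (lieCoord r M a)² ≤ Re tr(M M†)` for every matrix `M`.
[cite: Hall2015, Theorem 3.20] -/
theorem stub_lieFrame :
    ∀ (G : Type) [Group G] [TopologicalSpace G] [CompactSpace G] (r : Literature.MathematicalPhysics.QuantumFieldTheory.LatticeRep G),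
      (∀ a b : Fin (Summit.QuantumFields.YangMills.Theorems.EquipartitionPinsProbe.lieDim r), Summit.QuantumFields.YangMills.Theorems.EquipartitionPinsProbe.lieCoord r (Summit.QuantumFields.YangMills.Theorems.EquipartitionPinsProbe.lieVec r a) b = if a = b then 1 else 0) ∧
      (∀ a : Fin (Summit.QuantumFields.YangMills.Theorems.EquipartitionPinsProbe.lieDim r), Matrix.conjTranspose (Summit.QuantumFields.YangMills.Theorems.EquipartitionPinsProbe.lieVec r a) = -Summit.QuantumFields.YangMills.Theorems.EquipartitionPinsProbe.lieVec r a) ∧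
      (∀ (a : Fin (Summit.QuantumFields.YangMills.Theorems.EquipartitionPinsProbe.lieDim r)) (t : ℝ), NormedSpace.exp ((t : ℂ) • Summit.QuantumFields.YangMills.Theorems.EquipartitionPinsProbe.lieVec r a) ∈ Set.range r.ρ) ∧
      (∀ X : Matrix (Fin r.N) (Fin r.N) ℂ,
        X ∈ Submodule.span ℝ {X : Matrix (Fin r.N) (Fin r.N) ℂ |
            ∀ t : ℝ, NormedSpace.exp ((t : ℂ) • X) ∈ Set.range r.ρ} →
          X = ∑ a : Fin (Summit.QuantumFields.YangMills.Theorems.EquipartitionPinsProbe.lieDim r), (Summit.QuantumFields.YangMills.Theorems.EquipartitionPinsProbe.lieCoord r X a : ℂ) • Summit.QuantumFields.YangMills.Theorems.EquipartitionPinsProbe.lieVec r a) ∧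
      (∀ M : Matrix (Fin r.N) (Fin r.N) ℂ,
        ∑ a : Fin (Summit.QuantumFields.YangMills.Theorems.EquipartitionPinsProbe.lieDim r), (Summit.QuantumFields.YangMills.Theorems.EquipartitionPinsProbe.lieCoord r M a) ^ 2 ≤ (M * Matrix.conjTranspose M).trace.re) := by
  intro G _ _ _ r
  -- the real Hilbert–Schmidt inner product `⟨A, B⟩ = Re tr(A† B)` on `M_N(ℂ)` (tree, a `def`)
  letI : InnerProductSpace ℝ (Matrix (Fin r.N) (Fin r.N) ℂ) := frobeniusInnerProductSpace
  -- `lieCoord r M a = ⟨e_a, M⟩`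
  have hcoord : ∀ (M : Matrix (Fin r.N) (Fin r.N) ℂ) (a : Fin (lieDim r)),
      lieCoord r M a = inner ℝ (lieVec r a) M := fun M a => by
    rw [lieCoord, frobenius_inner_def, Matrix.trace_mul_comm]
  -- the frame is orthonormal: image of an orthonormal basis under a linear isometry, re-indexed
  have hON : Orthonormal ℝ (lieVec r) := by
    rw [lieVec_eq_comp]
    exact ((EuclideanSpace.basisFun _ ℝ).orthonormal.comp_linearIsometry _).comp _
      (finCongr _).injective
  -- `⟨e_a, lieIso v⟩ = v_{a'}`, `a'` the transported index
  have hinner : ∀ (a : Fin (lieDim r))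
      (v : EuclideanSpace ℝ (Fin (FreeEnergyLogCoefficient.dimE r.ρ))),
      inner ℝ (lieVec r a) (FreeEnergyLogCoefficient.lieIso r.ρ v) =
        v (finCongr (dimE_eq_lieDim r).symm a) := fun a v => by
    rw [lieVec_eq, LinearIsometry.inner_map_map, EuclideanSpace.basisFun_inner]
  refine ⟨fun a b => ?_, fun a => FreeEnergyLogCoefficient.conjTranspose_lieIso r.ρ _,
    fun a t => (mem_repLieAlgebra_iff r).1 (FreeEnergyLogCoefficient.lieIso_mem r.ρ _) t,
    fun X hX => ?_, fun M => ?_⟩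
  · -- (1) orthonormality
    rw [hcoord, real_inner_comm, orthonormal_iff_ite.1 hON a b]
  · -- (4) completeness: `X = lieIso v`; expand `v` in the standard basis of `ℝ^D`
    obtain ⟨v, rfl⟩ := FreeEnergyLogCoefficient.exists_lieIso_eq r.ρ r.mem_unitary hX
    conv_lhs => rw [← (EuclideanSpace.basisFun _ ℝ).sum_repr v, map_sum]
    refine Fintype.sum_equiv (finCongr (dimE_eq_lieDim r)) _ _ fun i => ?_
    rw [map_smul, EuclideanSpace.basisFun_repr, hcoord, hinner, lieVec_eq,
      ← finCongr_symm (dimE_eq_lieDim r), Equiv.symm_apply_apply]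
    rfl
  · -- (5) Bessel's inequality for the orthonormal family `e_a`
    have h := hON.sum_inner_products_le M (s := Finset.univ)
    simp only [← hcoord, Real.norm_eq_abs, sq_abs] at h
    rwa [← trace_mul_conjTranspose_re] at h

end Summit.QuantumFields.YangMills.Theorems.EquipartitionPinsProbe

end
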